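import Summits.Ventures.PercRepro.GZSwapA
import Summits.Ventures.PercRepro.C026TwoHubDefs

/-!
# STEP 1 of THEOREM B, the sources: `(D,A)` on the two-hub skeleton in hub-graph terms (p6, gen 22)

On `H = G.attachTwoHub a b h h'` (C026TwoHubDefs: `G` = the hub graph `G⁺` with `a, b` edgeless,
plus `0 = h–a`, `1 = h–b`, `2 = h'–a`, `3 = h'–b`, `4 = a–b`), a configuration `S` (red = open) is a
`(D,A)` source — `c, a, b` pairwise red-joined and pairwise blue-separated — iff (mine-3's STEP 1,
MINE3-GLUING.md §40 (j)):

* the terminal edge `4` is red; each hub has a red terminal edge (`0 ∨ 1`, `2 ∨ 3`: no `BB` hub);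
* `c` is red-joined in `G⁺` to a hub (`R ∨ R'`);
* `c` is blue-separated in `G⁺` from every hub with a blue terminal edge (`¬B` / `¬B'`);
* no hub with a blue `a`-edge is blue-joined in `G⁺` to a hub with a blue `b`-edge (`¬B''`).

`DA_attach_iff` is that equivalence, with `O = S ∘ Sum.inl` the hub-graph colouring.  The red half
is the explicit path through the hubs and the terminal edge; the blue half is the closed-boundary
argument (`mem_of_conn_of_closed_boundary`) for the blue cluster of `c` (`cluster_compl_c_subset`)
and for the blue cluster of `a` (`cluster_compl_a_subset`), whose boundary edges are all red under
the conditions.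
-/

namespace PercRepro

namespace MultiGraph

open Finset

variable {V E : Type*} {G : MultiGraph V E} {a b h h' c : V}

/-- A vertex without edges belongs to no cluster but its own. -/
theorem not_mem_cluster_of_isolated {ω : Config E} {v w : V}
    (hw : ∀ e, G.fst e ≠ w ∧ G.snd e ≠ w) (hvw : v ≠ w) : w ∉ G.cluster ω v := fun hmem =>
  hvw (eq_of_conn_of_isolated (fun e _ => hw e) ((G.mem_cluster).1 hmem).symm)

/-- An open new edge of the attachment joins its endpoints. -/
theorem openAdj_attach_inr {S : Config (E ⊕ Fin 5)} {i : Fin 5} (hi : S (Sum.inr i) = true) :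
    (G.attachTwoHub a b h h').OpenAdj S (![h, h, h', h', a] i) (![a, b, a, b, b] i) :=
  (G.attachTwoHub a b h h').openAdj_of_open (Sum.inr i) hi

/-- A blue new edge of the attachment joins its endpoints in the complement. -/
theorem openAdj_attach_compl_inr {S : Config (E ⊕ Fin 5)} {i : Fin 5} (hi : S (Sum.inr i) = false) :
    (G.attachTwoHub a b h h').OpenAdj Sᶜ (![h, h, h', h', a] i) (![a, b, a, b, b] i) :=
  (G.attachTwoHub a b h h').openAdj_of_open (Sum.inr i) (by rw [compl_apply_not, hi]; rfl)

/-- A blue hub-graph connection is a blue connection of the attachment. -/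
theorem conn_attach_compl_of_conn {S : Config (E ⊕ Fin 5)} {x y : V}
    (hxy : G.Conn (S ∘ Sum.inl)ᶜ x y) : (G.attachTwoHub a b h h').Conn Sᶜ x y := by
  rw [← compl_comp_inl] at hxy
  exact conn_attach_of_conn hxy

section Sources

variable (hab : a ≠ b) (hca : c ≠ a) (hcb : c ≠ b) (hha : h ≠ a) (hhb : h ≠ b) (hh'a : h' ≠ a)
  (hh'b : h' ≠ b) (hisoa : ∀ e, G.fst e ≠ a ∧ G.snd e ≠ a) (hisob : ∀ e, G.fst e ≠ b ∧ G.snd e ≠ b)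

include hca hcb hisoa hisob in
/-- **The red entry**: a red walk of the attachment from `c` to a terminal enters the terminals
through a hub red-joined to `c` in the hub graph. -/
theorem exists_hub_conn_of_conn_attach {S : Config (E ⊕ Fin 5)} {t : V} (ht : t = a ∨ t = b)
    (hct : (G.attachTwoHub a b h h').Conn S c t) :
    G.Conn (S ∘ Sum.inl) c h ∨ G.Conn (S ∘ Sum.inl) c h' := by
  have hc : c ∉ ({a, b} : Set V) := by
    simp only [Set.mem_insert_iff, Set.mem_singleton_iff, not_or]
    exact ⟨hca, hcb⟩
  have ht' : t ∈ ({a, b} : Set V) := by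
    simp only [Set.mem_insert_iff, Set.mem_singleton_iff]
    exact ht
  obtain ⟨x, hx, w, hw, hwalk, hxw⟩ := exists_entry hct hc ht'
  have hcx : G.Conn (S ∘ Sum.inl) c x :=
    ((walkAvoiding_attach_iff (by simp) (by simp)).1 ⟨hc, hwalk⟩).conn
  simp only [Set.mem_insert_iff, Set.mem_singleton_iff, not_or] at hx hw
  obtain ⟨f, _, hend⟩ := hxw
  rcases f with e | i
  · exfalso
    rcases hend with ⟨_, h2⟩ | ⟨h1, _⟩
    · rcases hw with rfl | rfl
      · exact (hisoa e).2 h2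
      · exact (hisob e).2 h2
    · rcases hw with rfl | rfl
      · exact (hisoa e).1 h1
      · exact (hisob e).1 h1
  · fin_cases i
    · rcases hend with ⟨h1, _⟩ | ⟨_, h2⟩
      · exact Or.inl ((show x = h from h1.symm) ▸ hcx)
      · exact absurd (show x = a from h2.symm) hx.1
    · rcases hend with ⟨h1, _⟩ | ⟨_, h2⟩
      · exact Or.inl ((show x = h from h1.symm) ▸ hcx)
      · exact absurd (show x = b from h2.symm) hx.2
    · rcases hend with ⟨h1, _⟩ | ⟨_, h2⟩
      · exact Or.inr ((show x = h' from h1.symm) ▸ hcx)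
      · exact absurd (show x = a from h2.symm) hx.1
    · rcases hend with ⟨h1, _⟩ | ⟨_, h2⟩
      · exact Or.inr ((show x = h' from h1.symm) ▸ hcx)
      · exact absurd (show x = b from h2.symm) hx.2
    · rcases hend with ⟨h1, _⟩ | ⟨_, h2⟩
      · exact absurd (show x = a from h1.symm) hx.1
      · exact absurd (show x = b from h2.symm) hx.2

/-- A hub with a red terminal edge is red-joined to both terminals once the terminal edge is red
(hub `h`, edges `0`, `1`). -/
theorem conn_terminals_of_hub_h {S : Config (E ⊕ Fin 5)} (h4 : S (Sum.inr 4) = true)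
    (h01 : S (Sum.inr 0) = true ∨ S (Sum.inr 1) = true) :
    (G.attachTwoHub a b h h').Conn S h a ∧ (G.attachTwoHub a b h h').Conn S h b := by
  have hab' : (G.attachTwoHub a b h h').Conn S a b := Conn.of_openAdj (openAdj_attach_inr h4)
  rcases h01 with h0 | h1
  · have := Conn.of_openAdj (openAdj_attach_inr (G := G) (a := a) (b := b) (h := h) (h' := h') h0)
    exact ⟨this, this.trans hab'⟩
  · have := Conn.of_openAdj (openAdj_attach_inr (G := G) (a := a) (b := b) (h := h) (h' := h') h1)
    exact ⟨this.trans hab'.symm, this⟩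

/-- The same for the hub `h'` (edges `2`, `3`). -/
theorem conn_terminals_of_hub_h' {S : Config (E ⊕ Fin 5)} (h4 : S (Sum.inr 4) = true)
    (h23 : S (Sum.inr 2) = true ∨ S (Sum.inr 3) = true) :
    (G.attachTwoHub a b h h').Conn S h' a ∧ (G.attachTwoHub a b h h').Conn S h' b := by
  have hab' : (G.attachTwoHub a b h h').Conn S a b := Conn.of_openAdj (openAdj_attach_inr h4)
  rcases h23 with h2 | h3
  · have := Conn.of_openAdj (openAdj_attach_inr (G := G) (a := a) (b := b) (h := h) (h' := h') h2)
    exact ⟨this, this.trans hab'⟩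
  · have := Conn.of_openAdj (openAdj_attach_inr (G := G) (a := a) (b := b) (h := h) (h' := h') h3)
    exact ⟨this.trans hab'.symm, this⟩

include hca hcb hisoa hisob in
/-- **The blue cluster of the probe stays in the hub graph** when every hub with a blue terminal
edge is blue-separated from `c` there and the terminal edge is red: it is contained in the
hub-graph blue cluster of `c`. -/
theorem cluster_compl_c_subset {S : Config (E ⊕ Fin 5)} (h4 : S (Sum.inr 4) = true)
    (hB0 : S (Sum.inr 0) = false → ¬ G.Conn (S ∘ Sum.inl)ᶜ c h)
    (hB1 : S (Sum.inr 1) = false → ¬ G.Conn (S ∘ Sum.inl)ᶜ c h)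
    (hB2 : S (Sum.inr 2) = false → ¬ G.Conn (S ∘ Sum.inl)ᶜ c h')
    (hB3 : S (Sum.inr 3) = false → ¬ G.Conn (S ∘ Sum.inl)ᶜ c h') :
    (G.attachTwoHub a b h h').cluster Sᶜ c ⊆ G.cluster (S ∘ Sum.inl)ᶜ c := by
  intro v hv
  refine mem_of_conn_of_closed_boundary (X := G.cluster (S ∘ Sum.inl)ᶜ c) ?_
    (G.self_mem_cluster _ c) ((G.attachTwoHub a b h h').mem_cluster.1 hv)
  intro f hf
  rcases f with e | i
  · exact mem_cluster_iff_of_open (ω := (S ∘ Sum.inl)ᶜ) (G := G) (a := c)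
      (by rw [← compl_comp_inl]; exact hf)
  · have hna : a ∉ G.cluster (S ∘ Sum.inl)ᶜ c := not_mem_cluster_of_isolated hisoa hca
    have hnb : b ∉ G.cluster (S ∘ Sum.inl)ᶜ c := not_mem_cluster_of_isolated hisob hcb
    rw [compl_apply_not, Bool.not_eq_true'] at hf
    fin_cases i
    · simp only [attachTwoHub_fst_inr, attachTwoHub_snd_inr]
      exact iff_of_false (fun hmem => hB0 hf ((G.mem_cluster).1 hmem)) hna
    · simp only [attachTwoHub_fst_inr, attachTwoHub_snd_inr]
      exact iff_of_false (fun hmem => hB1 hf ((G.mem_cluster).1 hmem)) hnb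
    · simp only [attachTwoHub_fst_inr, attachTwoHub_snd_inr]
      exact iff_of_false (fun hmem => hB2 hf ((G.mem_cluster).1 hmem)) hna
    · simp only [attachTwoHub_fst_inr, attachTwoHub_snd_inr]
      exact iff_of_false (fun hmem => hB3 hf ((G.mem_cluster).1 hmem)) hnb
    · exact absurd (hf.symm.trans h4) Bool.false_ne_true

include hab hha hhb hh'a hh'b hisoa hisob in
/-- **The blue cluster of the terminal `a` in the attachment** is contained in `a` together with
the hub-graph blue clusters of the hubs whose `a`-edge is blue, when no hub is `BB` and no hub
with a blue `a`-edge is blue-joined to a hub with a blue `b`-edge. -/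
theorem cluster_compl_a_subset {S : Config (E ⊕ Fin 5)} (h4 : S (Sum.inr 4) = true)
    (h01 : S (Sum.inr 0) = true ∨ S (Sum.inr 1) = true)
    (h23 : S (Sum.inr 2) = true ∨ S (Sum.inr 3) = true)
    (hB03 : S (Sum.inr 0) = false → S (Sum.inr 3) = false → ¬ G.Conn (S ∘ Sum.inl)ᶜ h h')
    (hB12 : S (Sum.inr 1) = false → S (Sum.inr 2) = false → ¬ G.Conn (S ∘ Sum.inl)ᶜ h h') :
    (G.attachTwoHub a b h h').cluster Sᶜ a ⊆
      {a} ∪ {v | S (Sum.inr 0) = false ∧ v ∈ G.cluster (S ∘ Sum.inl)ᶜ h} ∪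
        {v | S (Sum.inr 2) = false ∧ v ∈ G.cluster (S ∘ Sum.inl)ᶜ h'} := by
  intro v hv
  refine mem_of_conn_of_closed_boundary ?_ (by simp) ((G.attachTwoHub a b h h').mem_cluster.1 hv)
  intro f hf
  rcases f with e | i
  · simp only [attachTwoHub_fst_inl, attachTwoHub_snd_inl, Set.mem_union, Set.mem_singleton_iff,
      Set.mem_setOf_eq]
    have hf' : (S ∘ Sum.inl)ᶜ e = true := by rw [← compl_comp_inl]; exact hf
    have hea := (hisoa e).1
    have hea' := (hisoa e).2
    have hh := mem_cluster_iff_of_open (ω := (S ∘ Sum.inl)ᶜ) (G := G) (a := h) hf'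
    have hh' := mem_cluster_iff_of_open (ω := (S ∘ Sum.inl)ᶜ) (G := G) (a := h') hf'
    constructor
    · rintro ((h1 | ⟨h0, hm⟩) | ⟨h2, hm⟩)
      · exact absurd h1 hea
      · exact Or.inl (Or.inr ⟨h0, hh.1 hm⟩)
      · exact Or.inr ⟨h2, hh'.1 hm⟩
    · rintro ((h1 | ⟨h0, hm⟩) | ⟨h2, hm⟩)
      · exact absurd h1 hea'
      · exact Or.inl (Or.inr ⟨h0, hh.2 hm⟩)
      · exact Or.inr ⟨h2, hh'.2 hm⟩
  · rw [compl_apply_not, Bool.not_eq_true'] at hf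
    have hbh : b ∉ G.cluster (S ∘ Sum.inl)ᶜ h := not_mem_cluster_of_isolated hisob hhb
    have hbh' : b ∉ G.cluster (S ∘ Sum.inl)ᶜ h' := not_mem_cluster_of_isolated hisob hh'b
    fin_cases i
    · -- `h–a` blue: both endpoints inside
      simp only [attachTwoHub_fst_inr, attachTwoHub_snd_inr, Set.mem_union,
        Set.mem_singleton_iff, Set.mem_setOf_eq]
      exact iff_of_true (Or.inl (Or.inr ⟨hf, G.self_mem_cluster _ h⟩)) (Or.inl (Or.inl rfl))
    · -- `h–b` blue: both endpoints outside
      simp only [attachTwoHub_fst_inr, attachTwoHub_snd_inr,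
        Set.mem_union, Set.mem_singleton_iff, Set.mem_setOf_eq]
      refine iff_of_false ?_ ?_
      · rintro ((h1 | ⟨h0, _⟩) | ⟨h2, hm⟩)
        · exact hha h1
        · simp only [h0, Bool.false_eq_true, false_or] at h01
          exact Bool.false_ne_true (hf.symm.trans h01)
        · exact hB12 hf h2 ((G.mem_cluster).1 hm).symm
      · rintro ((h1 | ⟨_, hm⟩) | ⟨_, hm⟩)
        · exact hab h1.symm
        · exact hbh hm
        · exact hbh' hm
    · -- `h'–a` blue: both endpoints inside
      simp only [attachTwoHub_fst_inr, attachTwoHub_snd_inr, Set.mem_union, Set.mem_singleton_iff,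
        Set.mem_setOf_eq]
      exact iff_of_true (Or.inr ⟨hf, G.self_mem_cluster _ h'⟩) (Or.inl (Or.inl rfl))
    · -- `h'–b` blue: both endpoints outside
      simp only [attachTwoHub_fst_inr, attachTwoHub_snd_inr, Set.mem_union, Set.mem_singleton_iff,
        Set.mem_setOf_eq]
      refine iff_of_false ?_ ?_
      · rintro ((h1 | ⟨h0, hm⟩) | ⟨h2, _⟩)
        · exact hh'a h1
        · exact hB03 h0 hf ((G.mem_cluster).1 hm)
        · simp only [h2, Bool.false_eq_true, false_or] at h23
          exact Bool.false_ne_true (hf.symm.trans h23)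
      · rintro ((h1 | ⟨_, hm⟩) | ⟨_, hm⟩)
        · exact hab h1.symm
        · exact hbh hm
        · exact hbh' hm
    · exact absurd (hf.symm.trans h4) Bool.false_ne_true

include hab hca hcb hha hhb hh'a hh'b hisoa hisob in
/-- **STEP 1 of THEOREM B, the sources**: `S` is a `(D,A)` source of the two-hub skeleton iff
the terminal edge is red, no hub is `BB`, `c` is red-joined in the hub graph to a hub, `c` is
blue-separated in the hub graph from every hub with a blue terminal edge, and no hub with a blue
`a`-edge is blue-joined in the hub graph to a hub with a blue `b`-edge. -/
theorem DA_attach_iff (S : Config (E ⊕ Fin 5)) :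
    (((G.attachTwoHub a b h h').Conn S c a ∧ (G.attachTwoHub a b h h').Conn S c b) ∧
      (¬ (G.attachTwoHub a b h h').Conn Sᶜ c a ∧ ¬ (G.attachTwoHub a b h h').Conn Sᶜ c b ∧
        ¬ (G.attachTwoHub a b h h').Conn Sᶜ a b)) ↔
    (S (Sum.inr 4) = true ∧ (S (Sum.inr 0) = true ∨ S (Sum.inr 1) = true) ∧
      (S (Sum.inr 2) = true ∨ S (Sum.inr 3) = true) ∧
      (G.Conn (S ∘ Sum.inl) c h ∨ G.Conn (S ∘ Sum.inl) c h') ∧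
      (S (Sum.inr 0) = false → ¬ G.Conn (S ∘ Sum.inl)ᶜ c h) ∧
      (S (Sum.inr 1) = false → ¬ G.Conn (S ∘ Sum.inl)ᶜ c h) ∧
      (S (Sum.inr 2) = false → ¬ G.Conn (S ∘ Sum.inl)ᶜ c h') ∧
      (S (Sum.inr 3) = false → ¬ G.Conn (S ∘ Sum.inl)ᶜ c h') ∧
      (S (Sum.inr 0) = false → S (Sum.inr 3) = false → ¬ G.Conn (S ∘ Sum.inl)ᶜ h h') ∧
      (S (Sum.inr 1) = false → S (Sum.inr 2) = false → ¬ G.Conn (S ∘ Sum.inl)ᶜ h h')) := by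
  constructor
  · rintro ⟨⟨hca', hcb'⟩, hAca, hAcb, hAab⟩
    have hab' : ∀ {x : V}, (G.attachTwoHub a b h h').Conn Sᶜ a x →
        (G.attachTwoHub a b h h').Conn Sᶜ x b → False := fun h1 h2 => hAab (h1.trans h2)
    have e0 : S (Sum.inr 0) = false →
        (G.attachTwoHub a b h h').Conn Sᶜ h a := fun hf => Conn.of_openAdj (openAdj_attach_compl_inr hf)
    have e1 : S (Sum.inr 1) = false →
        (G.attachTwoHub a b h h').Conn Sᶜ h b := fun hf => Conn.of_openAdj (openAdj_attach_compl_inr hf)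
    have e2 : S (Sum.inr 2) = false →
        (G.attachTwoHub a b h h').Conn Sᶜ h' a := fun hf =>
      Conn.of_openAdj (openAdj_attach_compl_inr hf)
    have e3 : S (Sum.inr 3) = false →
        (G.attachTwoHub a b h h').Conn Sᶜ h' b := fun hf =>
      Conn.of_openAdj (openAdj_attach_compl_inr hf)
    refine ⟨?_, ?_, ?_, exists_hub_conn_of_conn_attach hca hcb hisoa hisob (Or.inl rfl) hca', ?_,
      ?_, ?_, ?_, ?_, ?_⟩
    · by_contra hf
      rw [Bool.not_eq_true] at hf
      exact hAab (Conn.of_openAdj (openAdj_attach_compl_inr hf))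
    · by_contra hf
      simp only [Bool.not_eq_true, not_or] at hf
      exact hab' (e0 hf.1).symm (e1 hf.2)
    · by_contra hf
      simp only [Bool.not_eq_true, not_or] at hf
      exact hab' (e2 hf.1).symm (e3 hf.2)
    · exact fun hf hB => hAca ((conn_attach_compl_of_conn hB).trans (e0 hf))
    · exact fun hf hB => hAcb ((conn_attach_compl_of_conn hB).trans (e1 hf))
    · exact fun hf hB => hAca ((conn_attach_compl_of_conn hB).trans (e2 hf))
    · exact fun hf hB => hAcb ((conn_attach_compl_of_conn hB).trans (e3 hf))
    · exact fun h0 h3 hB => hab' (e0 h0).symm ((conn_attach_compl_of_conn hB).trans (e3 h3))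
    · exact fun h1 h2 hB => hab' (e2 h2).symm ((conn_attach_compl_of_conn hB.symm).trans (e1 h1))
  · rintro ⟨h4, h01, h23, hR, hB0, hB1, hB2, hB3, hB03, hB12⟩
    refine ⟨?_, ?_, ?_, ?_⟩
    · rcases hR with hR | hR
      · have := conn_terminals_of_hub_h (G := G) (a := a) (b := b) (h := h) (h' := h') h4 h01
        exact ⟨(conn_attach_of_conn hR).trans this.1, (conn_attach_of_conn hR).trans this.2⟩
      · have := conn_terminals_of_hub_h' (G := G) (a := a) (b := b) (h := h) (h' := h') h4 h23
        exact ⟨(conn_attach_of_conn hR).trans this.1, (conn_attach_of_conn hR).trans this.2⟩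
    · intro hc
      exact not_mem_cluster_of_isolated hisoa hca
        (cluster_compl_c_subset hca hcb hisoa hisob h4 hB0 hB1 hB2 hB3
          ((G.attachTwoHub a b h h').mem_cluster.2 hc))
    · intro hc
      exact not_mem_cluster_of_isolated hisob hcb
        (cluster_compl_c_subset hca hcb hisoa hisob h4 hB0 hB1 hB2 hB3
          ((G.attachTwoHub a b h h').mem_cluster.2 hc))
    · intro hc
      have hmem := cluster_compl_a_subset hab hha hhb hh'a hh'b hisoa hisob h4 h01 h23 hB03 hB12
        ((G.attachTwoHub a b h h').mem_cluster.2 hc)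
      simp only [Set.mem_union, Set.mem_singleton_iff, Set.mem_setOf_eq] at hmem
      rcases hmem with (h1 | ⟨_, hm⟩) | ⟨_, hm⟩
      · exact hab h1.symm
      · exact not_mem_cluster_of_isolated hisob hhb hm
      · exact not_mem_cluster_of_isolated hisob hh'b hm

end Sources

end MultiGraph

end PercRepro
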